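import Literature.Topology.FourManifolds.LatticeFormsReflectionPairsCommutators
import Literature.Topology.FourManifolds.LatticeFormsOrthogonalGroupAbelianisationOrder
import HarnessLib

/-!
# Characters of `O⁺(L)` on the `(−2)`-reflections, for every even unimodular lattice with two hyperbolic planes:
# one conjugacy class, one value of square `1`, `⟨σ_a⟩/[O⁺, O⁺]` has exactly two classes
# (Gritsenko–Hulek–Sankaran, *J. Algebra* 322 (2009) Cor. 1.8, Thm. 1.3 (proof), Prop. 1.6 (proof); GHS, *Doc. Math.* 13 (2008) Prop. 2.4 (i))

Trunk T-4MAN vocabulary. Sequel of `LatticeFormsReflectionPairsCommutators.lean` (row g50-#9: for every symmetric even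
unimodular `L` with `n₊, n₋ ≥ 2`, `σ_aσ_b ∈ [O⁺(L), O⁺(L)]`-words for all `(−2)`-vectors `a, b`, by the printed proof of
Prop. 1.6) and of rows g50-#3/#6 (Cor. 1.8 and the abelianisation counts for `L ≅ U^{⊕n}`). GHS Cor. 1.8 — "`Õ⁺(L)` has only one
non-trivial character, namely `det`" — rests on two mechanisms: characters kill commutators, and (proof of Thm. 1.3)
"`σ_{g(a)} = gσ_ag⁻¹`", so that conjugate reflections have the same image. This file runs both for the subgroup
`Ref₋₂(L) = ⟨σ_a : a² = −2⟩ ⊆ O⁺(L)` of EVERY symmetric even unimodular lattice with `n± ≥ 2` (`II_{p,q} ⊇ 2U`; under Kneser's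
conditions `Ref₋₂(L) = O⁺(L)`, which the tree has for `L ≅ U^{⊕n}`, `n ≥ 3`): the `(−2)`-reflections form ONE conjugacy class of
`O⁺(L)`; every character of `O⁺(L)` (map to an abelian group, multiplicative on `O⁺(L)`) takes one and the same value `c` with
`c² = 1` on all of them, is `1` on the words of determinant `1`, and takes only the values `1, c` on `Ref₋₂(L)` — it factors
through `det`; and `Ref₋₂(L)` has exactly two classes modulo `[O⁺(L), O⁺(L)]`-words (Thm. 1.3's bound `2^N`, `N = 1`, attained).
Written for lane `lit-hodgefound` (Track 2 foundations; prover seat `lit-hodgefound-p18`, gen 50, row g50-#11). THEOREMS ONLY —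
no definition, no named fact, no instance, no notation.

## Sources, verbatim

* GHS 2009 (held `paper:arxiv-0810.1614`) p. 4, **Corollary 1.8** "For `L` a lattice as in Theorem 1.7, the orthogonal group `Õ⁺(L)`
  has only one non-trivial character, namely `det`, and `S̃O⁺(L)` has no non-trivial characters."; p. 3, proof of Thm. 1.3:
  "if there exists `g ∈ Õ⁺(L)` such that `g(a) = b` […] `σ_{g(a)} = gσ_ag⁻¹` and `σ_aσ_b ∈ [Õ⁺(L), Õ⁺(L)]`"; Thm. 1.3: "Its
  order divides `2^N` […] where `N` is the number of different `Õ⁺(L)`-orbits […] of `(−2)`-vectors".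
* GHS 2008 Prop. 2.4 (i) (tree: `exists_isometryEquiv_isOrientationPreserving_apply_eq_of_apply_self_eq_neg_two`): one
  `O⁺`-orbit of `(−2)`-vectors in an even unimodular lattice with `n± ≥ 2`.

## Contents (all proved)

* §1 (any symmetric non-degenerate lattice) a character of `O⁺(L)` has `f(σ_a)² = 1` on every `(−2)`-reflection.
* §2 (symmetric even unimodular, `n± ≥ 2`) the `(−2)`-reflections are conjugate in `O⁺(L)`
  (`exists_isOrientationPreserving_normTwoReflectionEquiv_eq_conj_of_isUnimodular`); characters of `O⁺(L)`: `= 1` on words in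
  `σ_aσ_b`, `= 1` on `(−2)`-reflection words of determinant `1`, equal on all `(−2)`-reflections, equal on words of equal
  determinant, two-valued on `Ref₋₂(L)`; **`|Ref₋₂(L) / [O⁺(L), O⁺(L)]-words| = 2`**
  (`natCard_quot_isWordIn_negTwoReflections_commutators_eq_two_of_isUnimodular`).
-/

noncomputable section

open Module
open LinearMap (BilinForm)
open LinearMap.BilinForm
open LinearMap.BilinForm (IsometryEquiv)

namespace Literature.Topology.FourManifolds

universe u

/-! ### §1 `f(σ_a)² = 1` (any symmetric non-degenerate lattice) -/

section Square

variable {W : Type*} [AddCommGroup W] [Module.Finite ℤ W] [Module.Free ℤ W] {B : BilinForm ℤ W} {A : Type*} [CommGroup A]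
  {f : B.IsometryEquiv B → A}

/-- **`f(σ_a)² = 1`** for every map `f` to an abelian group multiplicative on `O⁺(L)` and every `(−2)`-reflection `σ_a ∈ O⁺(L)`
(`σ_a² = 1`). [cite: GritsenkoHulekSankaran2009, Cor. 1.8 and Thm. 1.3 ("an abelian 2-group")] -/
theorem character_normTwoReflectionEquiv_mul_self (hB : B.IsSymm) (hnd : B.Nondegenerate)
    (hf : ∀ α β : B.IsometryEquiv B, α.IsOrientationPreserving → β.IsOrientationPreserving → f (α.trans β) = f α * f β)
    {a : W} (ha : B a a = -1 + -1) :
    f (normTwoReflectionEquiv hB a (-1) ha (by norm_num)) * f (normTwoReflectionEquiv hB a (-1) ha (by norm_num)) = 1 := by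
  have hσ : (normTwoReflectionEquiv hB a (-1) ha (by norm_num)).IsOrientationPreserving :=
    (isOrientationPreserving_normTwoReflectionEquiv_iff _ hB hnd a (-1) ha _).2 rfl
  rw [← hf _ _ hσ hσ, show (normTwoReflectionEquiv hB a (-1) ha (by norm_num)).trans (normTwoReflectionEquiv hB a (-1) ha (by norm_num)) =
      LinearMap.BilinForm.IsometryEquiv.refl B from DFunLike.ext _ _ fun v ↦ by
        have h := LinearMap.BilinForm.IsometryEquiv.symm_apply_apply (normTwoReflectionEquiv hB a (-1) ha (by norm_num)) v
        rw [normTwoReflectionEquiv_symm] at h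
        rw [LinearMap.BilinForm.IsometryEquiv.trans_apply, h, LinearMap.BilinForm.IsometryEquiv.refl_apply]]
  exact map_refl_eq_one_of_map_trans (G := fun α : B.IsometryEquiv B ↦ α.IsOrientationPreserving)
    LinearMap.BilinForm.IsometryEquiv.IsOrientationPreserving.refl hf

/-- **Characters of `O⁺(L)` kill the words in commutators of `O⁺(L)`** (the tree's `IsWordIn.map_eq_one_of_commutators_of_map_trans`
specialised to `G = O⁺(L)`). [cite: GritsenkoHulekSankaran2009, Cor. 1.8] -/
theorem character_eq_one_of_isWordIn_commutators_isOrientationPreserving (hB : B.IsSymm) (hnd : B.Nondegenerate)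
    (hf : ∀ α β : B.IsometryEquiv B, α.IsOrientationPreserving → β.IsOrientationPreserving → f (α.trans β) = f α * f β)
    {φ : B.IsometryEquiv B}
    (hφ : IsWordIn {ψ : B.IsometryEquiv B | ∃ α β : B.IsometryEquiv B, α.IsOrientationPreserving ∧ β.IsOrientationPreserving ∧
      ψ = ((β.symm.trans α.symm).trans β).trans α} φ) :
    φ.IsOrientationPreserving ∧ f φ = 1 :=
  IsWordIn.map_eq_one_of_commutators_of_map_trans (G := fun α : B.IsometryEquiv B ↦ α.IsOrientationPreserving)
    LinearMap.BilinForm.IsometryEquiv.IsOrientationPreserving.refl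
    (fun α β hα hβ ↦ (LinearMap.BilinForm.IsometryEquiv.isOrientationPreserving_trans_iff hB hnd α β).2 (iff_of_true hβ hα))
    (fun α hα ↦ (LinearMap.BilinForm.IsometryEquiv.isOrientationPreserving_symm_iff hB hnd α).2 hα) hf (fun _ hs ↦ hs) hφ

end Square

/-! ### §2 Symmetric even unimodular lattices with `n± ≥ 2` -/

section Unimodular

variable {V : Type u} [AddCommGroup V] [Module.Finite ℤ V] [Module.Free ℤ V] (Q : BilinForm ℤ V) {A : Type*} [CommGroup A]
  {f : Q.IsometryEquiv Q → A}

/-- **The `(−2)`-reflections form one conjugacy class of `O⁺(L)`**: "`σ_{g(a)} = gσ_ag⁻¹`" with `g ∈ O⁺(L)`, `g(a) = b` (one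
`O⁺`-orbit of `(−2)`-vectors, GHS 2008 Prop. 2.4 (i)) — for every symmetric even unimodular lattice with `n₊, n₋ ≥ 2`.
[cite: GritsenkoHulekSankaran2009, Thm. 1.3 (proof: "σ_{g(a)} = gσ_ag⁻¹")] [cite: GritsenkoHulekSankaran2008Proportionality, Prop. 2.4 (i)] -/
theorem exists_isOrientationPreserving_normTwoReflectionEquiv_eq_conj_of_isUnimodular (hs : Q.IsSymm) (hu : Q.IsUnimodular)
    (he : Q.IsEven) (h2 : 2 ≤ sigPos Q.toQuadraticMap) (h2' : 2 ≤ sigNeg Q.toQuadraticMap) {a b : V} (ha : Q a a = -1 + -1)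
    (hb : Q b b = -1 + -1) :
    ∃ g : Q.IsometryEquiv Q, g.IsOrientationPreserving ∧
      ∀ v, normTwoReflectionEquiv hs b (-1) hb (by norm_num) v = g (normTwoReflectionEquiv hs a (-1) ha (by norm_num) (g.symm v)) := by
  obtain ⟨g, hg, hgab⟩ := exists_isometryEquiv_isOrientationPreserving_apply_eq_of_apply_self_eq_neg_two Q hs hu he h2 h2'
    (r := a) (s := b) (by rw [ha]; norm_num) (by rw [hb]; norm_num)
  subst hgab
  refine ⟨g, hg, fun v ↦ ?_⟩
  rw [← normTwoReflectionEquiv_conj_apply hs hs g ha (by norm_num) hb v, LinearMap.BilinForm.IsometryEquiv.trans_apply,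
    LinearMap.BilinForm.IsometryEquiv.trans_apply]

/-- **Characters of `O⁺(L)` kill `⟨σ_aσ_b : a² = b² = −2⟩`** for every symmetric even unimodular lattice with `n± ≥ 2` (the pairs are
words in commutators of `O⁺(L)`, row g50-#9). [cite: GritsenkoHulekSankaran2009, Cor. 1.8 and Prop. 1.6 (proof)] [cite: GritsenkoHulekSankaran2008Proportionality, Prop. 2.4 (i)] -/
theorem character_eq_one_of_isWordIn_negTwoReflectionPairs_of_isUnimodular (hs : Q.IsSymm) (hu : Q.IsUnimodular) (he : Q.IsEven)
    (h2 : 2 ≤ sigPos Q.toQuadraticMap) (h2' : 2 ≤ sigNeg Q.toQuadraticMap)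
    (hf : ∀ α β : Q.IsometryEquiv Q, α.IsOrientationPreserving → β.IsOrientationPreserving → f (α.trans β) = f α * f β)
    {φ : Q.IsometryEquiv Q}
    (hφ : IsWordIn {χ : Q.IsometryEquiv Q | ∃ s ∈ {ψ : Q.IsometryEquiv Q | ∃ (r : V) (hr : Q r r = -1 + -1),
        ψ = normTwoReflectionEquiv hs r (-1) hr (by norm_num)}, ∃ t ∈ {ψ : Q.IsometryEquiv Q | ∃ (r : V) (hr : Q r r = -1 + -1),
        ψ = normTwoReflectionEquiv hs r (-1) hr (by norm_num)}, χ = s.trans t} φ) :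
    f φ = 1 :=
  (character_eq_one_of_isWordIn_commutators_isOrientationPreserving hs hu.nondegenerate hf
    (isWordIn_commutators_isOrientationPreserving_of_isWordIn_negTwoReflectionPairs_of_isUnimodular Q hs hu he h2 h2' hφ)).2

/-- **Characters of `O⁺(L)` are `1` on the `(−2)`-reflection words of determinant `1`** (every symmetric even unimodular lattice
with `n± ≥ 2`). [cite: GritsenkoHulekSankaran2009, Cor. 1.8 and Thm. 1.3] [cite: GritsenkoHulekSankaran2008Proportionality, Prop. 2.4 (i)] -/
theorem character_eq_one_of_isWordIn_negTwoReflections_of_det_eq_one_of_isUnimodular (hs : Q.IsSymm) (hu : Q.IsUnimodular)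
    (he : Q.IsEven) (h2 : 2 ≤ sigPos Q.toQuadraticMap) (h2' : 2 ≤ sigNeg Q.toQuadraticMap)
    (hf : ∀ α β : Q.IsometryEquiv Q, α.IsOrientationPreserving → β.IsOrientationPreserving → f (α.trans β) = f α * f β)
    {φ : Q.IsometryEquiv Q}
    (hφ : IsWordIn {ψ : Q.IsometryEquiv Q | ∃ (r : V) (hr : Q r r = -1 + -1), ψ = normTwoReflectionEquiv hs r (-1) hr (by norm_num)} φ)
    (hdet : LinearMap.det (φ : V →ₗ[ℤ] V) = 1) : f φ = 1 :=
  (character_eq_one_of_isWordIn_commutators_isOrientationPreserving hs hu.nondegenerate hf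
    ((isWordIn_commutators_isOrientationPreserving_iff_det_eq_one_of_isWordIn_negTwoReflections_of_isUnimodular Q hs hu he h2 h2'
      hφ).2 hdet)).2

/-- **All `(−2)`-reflections have the same image under every character of `O⁺(L)`** (they are conjugate in `O⁺(L)`; equivalently
`f(σ_a)f(σ_b) = f(σ_aσ_b) = 1` and `f(σ_a)² = 1`) — every symmetric even unimodular lattice with `n± ≥ 2`.
[cite: GritsenkoHulekSankaran2009, Cor. 1.8 and Thm. 1.3 (proof)] [cite: GritsenkoHulekSankaran2008Proportionality, Prop. 2.4 (i)] -/
theorem character_normTwoReflectionEquiv_eq_of_isUnimodular (hs : Q.IsSymm) (hu : Q.IsUnimodular) (he : Q.IsEven)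
    (h2 : 2 ≤ sigPos Q.toQuadraticMap) (h2' : 2 ≤ sigNeg Q.toQuadraticMap)
    (hf : ∀ α β : Q.IsometryEquiv Q, α.IsOrientationPreserving → β.IsOrientationPreserving → f (α.trans β) = f α * f β)
    {a b : V} (ha : Q a a = -1 + -1) (hb : Q b b = -1 + -1) :
    f (normTwoReflectionEquiv hs a (-1) ha (by norm_num)) = f (normTwoReflectionEquiv hs b (-1) hb (by norm_num)) := by
  have hσa : (normTwoReflectionEquiv hs a (-1) ha (by norm_num)).IsOrientationPreserving :=
    (isOrientationPreserving_normTwoReflectionEquiv_iff _ hs hu.nondegenerate a (-1) ha _).2 rfl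
  have hσb : (normTwoReflectionEquiv hs b (-1) hb (by norm_num)).IsOrientationPreserving :=
    (isOrientationPreserving_normTwoReflectionEquiv_iff _ hs hu.nondegenerate b (-1) hb _).2 rfl
  have hab : f (normTwoReflectionEquiv hs a (-1) ha (by norm_num)) * f (normTwoReflectionEquiv hs b (-1) hb (by norm_num)) = 1 := by
    rw [← hf _ _ hσa hσb]
    refine character_eq_one_of_isWordIn_negTwoReflectionPairs_of_isUnimodular Q hs hu he h2 h2' hf (IsWordIn.of_mem ?_)
    exact ⟨_, ⟨a, ha, rfl⟩, _, ⟨b, hb, rfl⟩, rfl⟩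
  have haa := character_normTwoReflectionEquiv_mul_self hs hu.nondegenerate hf ha
  exact mul_left_cancel (haa.trans hab.symm)

/-- **Characters of `O⁺(L)` factor through `det` on `Ref₋₂(L)`**: two words in the `(−2)`-reflections with the same determinant have
the same image under every character of `O⁺(L)` (every symmetric even unimodular lattice with `n± ≥ 2`).
[cite: GritsenkoHulekSankaran2009, Cor. 1.8 ("only one non-trivial character, namely det")] [cite: GritsenkoHulekSankaran2008Proportionality, Prop. 2.4 (i)] -/
theorem character_eq_of_isWordIn_negTwoReflections_of_det_eq_of_isUnimodular (hs : Q.IsSymm) (hu : Q.IsUnimodular) (he : Q.IsEven)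
    (h2 : 2 ≤ sigPos Q.toQuadraticMap) (h2' : 2 ≤ sigNeg Q.toQuadraticMap)
    (hf : ∀ α β : Q.IsometryEquiv Q, α.IsOrientationPreserving → β.IsOrientationPreserving → f (α.trans β) = f α * f β)
    {φ ρ : Q.IsometryEquiv Q}
    (hφ : IsWordIn {ψ : Q.IsometryEquiv Q | ∃ (r : V) (hr : Q r r = -1 + -1), ψ = normTwoReflectionEquiv hs r (-1) hr (by norm_num)} φ)
    (hρ : IsWordIn {ψ : Q.IsometryEquiv Q | ∃ (r : V) (hr : Q r r = -1 + -1), ψ = normTwoReflectionEquiv hs r (-1) hr (by norm_num)} ρ)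
    (hdet : LinearMap.det (φ : V →ₗ[ℤ] V) = LinearMap.det (ρ : V →ₗ[ℤ] V)) : f φ = f ρ := by
  have hnd := hu.nondegenerate
  have hO : ∀ s ∈ {ψ : Q.IsometryEquiv Q | ∃ (r : V) (hr : Q r r = -1 + -1), ψ = normTwoReflectionEquiv hs r (-1) hr (by norm_num)},
      s.IsOrientationPreserving := by
    rintro s ⟨r, hr, rfl⟩
    exact (isOrientationPreserving_normTwoReflectionEquiv_iff _ hs hnd r (-1) hr _).2 rfl
  have hφO := hφ.isOrientationPreserving hs hnd hO
  have hρO := hρ.isOrientationPreserving hs hnd hO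
  have hρO' : ρ.symm.IsOrientationPreserving := (LinearMap.BilinForm.IsometryEquiv.isOrientationPreserving_symm_iff hs hnd ρ).2 hρO
  have h1 : f (φ.trans ρ.symm) = 1 :=
    (character_eq_one_of_isWordIn_commutators_isOrientationPreserving hs hnd hf
      ((isWordIn_commutators_isOrientationPreserving_trans_symm_iff_of_isWordIn_negTwoReflections_of_isUnimodular Q hs hu he h2
        h2' hφ hρ).2 hdet)).2
  rw [hf φ ρ.symm hφO hρO', map_symm_eq_inv_of_map_trans (G := fun α : Q.IsometryEquiv Q ↦ α.IsOrientationPreserving)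
    LinearMap.BilinForm.IsometryEquiv.IsOrientationPreserving.refl
    (fun α hα ↦ (LinearMap.BilinForm.IsometryEquiv.isOrientationPreserving_symm_iff hs hnd α).2 hα) hf hρO] at h1
  exact mul_inv_eq_one.1 h1

/-- **Characters of `O⁺(L)` are two-valued on `Ref₋₂(L)`**: on a word in the `(−2)`-reflections a character of `O⁺(L)` takes the
value `1` (determinant `1`) or the common value `f(σ_a)` of the reflections (determinant `−1`) — every symmetric even
unimodular lattice with `n± ≥ 2`, any `(−2)`-vector `a`. [cite: GritsenkoHulekSankaran2009, Cor. 1.8 and Thm. 1.3] [cite: GritsenkoHulekSankaran2008Proportionality, Prop. 2.4 (i)] -/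
theorem character_eq_one_or_eq_of_isWordIn_negTwoReflections_of_isUnimodular (hs : Q.IsSymm) (hu : Q.IsUnimodular)
    (he : Q.IsEven) (h2 : 2 ≤ sigPos Q.toQuadraticMap) (h2' : 2 ≤ sigNeg Q.toQuadraticMap)
    (hf : ∀ α β : Q.IsometryEquiv Q, α.IsOrientationPreserving → β.IsOrientationPreserving → f (α.trans β) = f α * f β)
    {φ : Q.IsometryEquiv Q}
    (hφ : IsWordIn {ψ : Q.IsometryEquiv Q | ∃ (r : V) (hr : Q r r = -1 + -1), ψ = normTwoReflectionEquiv hs r (-1) hr (by norm_num)} φ)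
    {a : V} (ha : Q a a = -1 + -1) :
    (LinearMap.det (φ : V →ₗ[ℤ] V) = 1 ∧ f φ = 1) ∨
      (LinearMap.det (φ : V →ₗ[ℤ] V) = -1 ∧ f φ = f (normTwoReflectionEquiv hs a (-1) ha (by norm_num))) := by
  rcases LinearMap.BilinForm.IsometryEquiv.det_eq_one_or_eq_neg_one φ with hd | hd
  · exact Or.inl ⟨hd, character_eq_one_of_isWordIn_negTwoReflections_of_det_eq_one_of_isUnimodular Q hs hu he h2 h2' hf hφ hd⟩
  · refine Or.inr ⟨hd, character_eq_of_isWordIn_negTwoReflections_of_det_eq_of_isUnimodular Q hs hu he h2 h2' hf hφ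
      (IsWordIn.of_mem ⟨a, ha, rfl⟩) ?_⟩
    rw [hd, det_normTwoReflectionEquiv _ hs]

/-- A `(−2)`-vector exists: `e − f` in one of the hyperbolic planes (`n± ≥ 2`). [cite: GritsenkoHulekSankaran2009, §1 ("σ_{e−f}")] [cite: GritsenkoHulekSankaran2008Proportionality, Prop. 2.4 (i)] -/
theorem exists_apply_self_eq_neg_two_of_isUnimodular (hs : Q.IsSymm) (hu : Q.IsUnimodular) (he : Q.IsEven)
    (h2 : 2 ≤ sigPos Q.toQuadraticMap) (h2' : 2 ≤ sigNeg Q.toQuadraticMap) : ∃ r : V, Q r r = -1 + -1 := by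
  obtain ⟨x, y, x₁, y₁, h⟩ := exists_twoHyperbolicPairs_of_isEven_of_isUnimodular Q hs hu he h2 h2'
  refine ⟨x - y, ?_⟩
  simp only [map_sub, LinearMap.sub_apply, h.xx, h.yy, h.xy, h.isSymm.eq y x]
  ring

/-- **`|Ref₋₂(L) / [O⁺(L), O⁺(L)]-words| = 2`** — Thm. 1.3's bound "`Õ⁺(L)^{ab}` has order dividing `2^N`" with `N = 1` orbit, attained,
for the reflection subgroup of every symmetric even unimodular lattice with `n± ≥ 2`: the words in the `(−2)`-reflections fall
into exactly two classes modulo words in commutators of `O⁺(L)`, cut out by `det`.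
[cite: GritsenkoHulekSankaran2009, Thm. 1.3 and Prop. 1.6] [cite: GritsenkoHulekSankaran2008Proportionality, Prop. 2.4 (i)] -/
theorem natCard_quot_isWordIn_negTwoReflections_commutators_eq_two_of_isUnimodular (hs : Q.IsSymm) (hu : Q.IsUnimodular)
    (he : Q.IsEven) (h2 : 2 ≤ sigPos Q.toQuadraticMap) (h2' : 2 ≤ sigNeg Q.toQuadraticMap) :
    Nat.card (Quot fun φ ρ : {φ : Q.IsometryEquiv Q // IsWordIn {ψ : Q.IsometryEquiv Q | ∃ (r : V) (hr : Q r r = -1 + -1),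
        ψ = normTwoReflectionEquiv hs r (-1) hr (by norm_num)} φ} ↦
      IsWordIn {ψ : Q.IsometryEquiv Q | ∃ α β : Q.IsometryEquiv Q, α.IsOrientationPreserving ∧ β.IsOrientationPreserving ∧
        ψ = ((β.symm.trans α.symm).trans β).trans α} (φ.1.trans ρ.1.symm)) = 2 := by
  classical
  obtain ⟨r, hr⟩ := exists_apply_self_eq_neg_two_of_isUnimodular Q hs hu he h2 h2'
  rw [show (2 : ℕ) = Nat.card Bool by simp]
  refine natCard_quot_eq_of_forall_iff _ (fun φ ↦ decide (LinearMap.det (φ.1 : V →ₗ[ℤ] V) = 1)) (fun a b ↦ ?_) ?_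
  · rw [isWordIn_commutators_isOrientationPreserving_trans_symm_iff_of_isWordIn_negTwoReflections_of_isUnimodular Q hs hu he h2 h2'
      a.2 b.2, decide_eq_decide]
    rcases LinearMap.BilinForm.IsometryEquiv.det_eq_one_or_eq_neg_one a.1 with ha | ha <;>
      rcases LinearMap.BilinForm.IsometryEquiv.det_eq_one_or_eq_neg_one b.1 with hb | hb <;> simp [ha, hb]
  · rintro (_ | _)
    · refine ⟨⟨normTwoReflectionEquiv hs r (-1) hr (by norm_num), IsWordIn.of_mem ⟨r, hr, rfl⟩⟩, ?_⟩
      simp [det_normTwoReflectionEquiv _ hs]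
    · refine ⟨⟨LinearMap.BilinForm.IsometryEquiv.refl Q, IsWordIn.refl⟩, ?_⟩
      simp [specialOrthogonal_refl.2]

end Unimodular

end Literature.Topology.FourManifolds

end
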